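import Summits.Ventures.Crystal3D.Theorems.StickyWulffConstantCoaxialWallLawCertifiedRungSealed
import HarnessLib

/-!
# The co-axial general-filling ledger in NET form: located in-plane exits minus foreign caps

HONEST FRAMING. Part of the venture `Summits/Ventures/Crystal3D` (cell `crystal3d-full`), helper
`--supports` the crux `CoaxialWallLaw` (stmt-Ventures-19481, `route-Ventures-StickyWulffConstant`),
REGISTERED line `WallLedgerF` (planner cf-p1 gen 16), stub `stub_coaxialTwoSlabAdhesion`.  Sharpening of
this seat's sealed co-axial rungs (`…CoaxialWallLawSealedRung`, `…CertifiedRungSealed`): there the located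
in-plane exit count `#EX` was immediately traded for the flux `√2|⟪A₁ w, e₃⟫| π ρ²`, leaving the residual
`#FTC` (foreign-twin-capped exits) ALONE on the right.  That residual is NOT small in general, even in cheap
fillings: a DECORATIVE foreign twin lamella inside grain 1 (two parallel coherent `n`-planes, cost only at its
rim `O(ρ)`) is crossed by `O((1+h)ρ)` in-plane lines, and `∼ s ρ/(1+h)` such lamellae inflate `#FTC` to order
`s ρ²` at cost `O(s ρ²/(1+h))` — but every crossing also creates one MORE located exit downstream (the line
re-enters grain 1 behind the lamella), so the NET count `#EX − #FTC` is untouched.  Hence the right currency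
is the net count, kept here explicitly:

* `coaxialTwoSlabAdhesion_netLedger_certified` — under the C12-55 row (BY NAME, as before), in the stub's own
  cell (no cleanliness hypotheses): `#EX ≥ √2|⟪A₁w,e₃⟫| π(ρ−1)² − O((1+h)ρ)` (flux `≥ (√6/2) sin θ`) AND
  `cross(P₁,X∖P₁) + cross(P₂,Y) ≤ D(Y) + (φ₁ + φ₂) π ρ² − ½ (#EX − #FTC) + C(1+h)ρ`;
* `coaxialTwoSlabAdhesion_netLedger` — the same with `KissingGap δ` / `KissingClassification δ` by name and
  `1/3770` for `½`.

So `stub_coaxialTwoSlabAdhesion` follows (with the C12-55 row) from the NET RISER COUNT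
`#EX − #FTC ≥ sin θ · π ρ² − C(1+h)ρ` — NOT filed as a hypothesis-reduction, because even the net count can
fall short in EXPENSIVE fillings (a foreign domain `Λ₁' = R_n Λ₁` resting on the bottom sample: the in-plane
lines under it end at the coherent `n`-plate while the cost sits in the `Λ₁ | Λ₁'` contact wall, which shallow
lines of grain 1 see only with weight `∝ sin θ`): the complement of this ledger is a wall floor for the
CHAIN pair `(Λ₁, R_n Λ₁)` across a non-twin plane — lane G's / the planner's business, recorded in the cell
notes.  Rung credit only; F-C1 not moved.

WHAT THIS IS NOT: not the stub; F-C1 not moved.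
-/

noncomputable section

namespace Summit.Ventures.Crystal3D.Theorems

open Summit.Ventures.Crystal3D Finset
open Literature.MathematicalPhysics.StatisticalMechanics (fccStacking barlowStacking IsHaggSeq contactDeficiency)
open scoped InnerProductSpace

open scoped Classical in
/-- **Net co-axial ledger, certified form.**  See the module docstring. -/
theorem coaxialTwoSlabAdhesion_netLedger_certified
    {s₀ : EuclideanSpace ℝ (Fin 3)} (hs₀ : s₀ ∈ fccSlots)
    (hcert : ExactOnly 0 (fccSlots.filter fun w => 0 < ⟪w, s₀⟫_ℝ))
    (A₁ : EuclideanSpace ℝ (Fin 3) ≃ₗᵢ[ℝ] EuclideanSpace ℝ (Fin 3)) (t₁ : EuclideanSpace ℝ (Fin 3))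
    (A₂ : EuclideanSpace ℝ (Fin 3) ≃ₗᵢ[ℝ] EuclideanSpace ℝ (Fin 3)) (t₂ : EuclideanSpace ℝ (Fin 3))
    (L : EuclideanSpace ℝ (Fin 3) ≃ₗᵢ[ℝ] EuclideanSpace ℝ (Fin 3)) (s₁ : EuclideanSpace ℝ (Fin 3))
    {σ : ℤ → ℤ} (hσ : IsHaggSeq σ)
    (hsub₁ : (fun p => A₁ p + t₁) '' fccStacking 1 (Real.sqrt (2 / 3)) ⊆
      (fun p => L p + s₁) '' barlowStacking 1 (Real.sqrt (2 / 3)) σ)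
    (hne : (fun p => A₁ p + t₁) '' fccStacking 1 (Real.sqrt (2 / 3)) ≠
      (fun p => A₂ p + t₂) '' fccStacking 1 (Real.sqrt (2 / 3))) :
    ∃ w ∈ fccSlots, ⟪A₁ w, L (EuclideanSpace.single (2 : Fin 3) (1 : ℝ))⟫_ℝ = 0 ∧
      0 ≤ ⟪A₁ w, EuclideanSpace.single (2 : Fin 3) (1 : ℝ)⟫_ℝ ∧
      Real.sqrt 6 * Real.sqrt (1 - ⟪L (EuclideanSpace.single (2 : Fin 3) (1 : ℝ)),
          EuclideanSpace.single (2 : Fin 3) (1 : ℝ)⟫_ℝ ^ 2) ≤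
        2 * (Real.sqrt 2 * |⟪A₁ w, EuclideanSpace.single (2 : Fin 3) (1 : ℝ)⟫_ℝ|) ∧
    ∃ C R₀ : ℝ, 1 ≤ R₀ ∧ ∀ h : ℝ, 0 ≤ h → ∀ ρ : ℝ, R₀ ≤ ρ →
      ∀ X P₁ P₂ : Finset (EuclideanSpace ℝ (Fin 3)),
      (∀ p ∈ X, ∀ q ∈ X, p ≠ q → 1 ≤ dist p q) → P₁ ⊆ X → P₂ ⊆ X \ P₁ →
      (∀ p ∈ X, -(2 * R₀) ≤ p 2 ∧ p 2 ≤ h + 2 * R₀ ∧ p 0 ^ 2 + p 1 ^ 2 ≤ ρ ^ 2) →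
      (∀ p, p ∈ P₁ ↔ (p ∈ (fun q => A₁ q + t₁) '' fccStacking 1 (Real.sqrt (2 / 3)) ∧
        -(2 * R₀) ≤ p 2 ∧ p 2 ≤ -R₀ ∧ p 0 ^ 2 + p 1 ^ 2 ≤ ρ ^ 2)) →
      (∀ p, p ∈ P₂ ↔ (p ∈ (fun q => A₂ q + t₂) '' fccStacking 1 (Real.sqrt (2 / 3)) ∧
        h + R₀ ≤ p 2 ∧ p 2 ≤ h + 2 * R₀ ∧ p 0 ^ 2 + p 1 ^ 2 ≤ ρ ^ 2)) →
      Real.sqrt 2 * |⟪A₁ w, EuclideanSpace.single (2 : Fin 3) (1 : ℝ)⟫_ℝ| * Real.pi * (ρ - 1) ^ 2 -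
          10 * Real.sqrt 2 * Real.pi * (ρ - 1) - 30 * (h + 4 * R₀ + 2) * (2 * ρ - 3) ≤
        (((X.filter fun e => (e ∈ (fun q => A₁ q + t₁) '' fccStacking 1 (Real.sqrt (2 / 3)) ∧
                e 2 < h + R₀ + 2 ∧ e 0 ^ 2 + e 1 ^ 2 ≤ (ρ - 3) ^ 2) ∧
                e - A₁ w ∈ X ∧ (∀ v ∈ fccSlots, e - A₁ w + A₁ v ∈ X) ∧
                ∃ v ∈ fccSlots, e + A₁ v ∉ X).card : ℕ) : ℝ) ∧
      ((((P₁ ×ˢ (X \ P₁)).filter fun pq => dist pq.1 pq.2 = 1).card : ℕ) : ℝ) +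
        ((((P₂ ×ˢ ((X \ P₁) \ P₂)).filter fun pq => dist pq.1 pq.2 = 1).card : ℕ) : ℝ) ≤
        contactDeficiency ((X \ P₁) \ P₂) +
          (Real.sqrt 2 / 4 * ∑ᶠ w ∈ {w ∈ fccStacking 1 (Real.sqrt (2 / 3)) | ‖w‖ = 1},
              |⟪w, A₁.symm (EuclideanSpace.single (2 : Fin 3) (1 : ℝ))⟫_ℝ| +
            Real.sqrt 2 / 4 * ∑ᶠ w ∈ {w ∈ fccStacking 1 (Real.sqrt (2 / 3)) | ‖w‖ = 1},
              |⟪w, A₂.symm (EuclideanSpace.single (2 : Fin 3) (1 : ℝ))⟫_ℝ|) * Real.pi * ρ ^ 2 -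
          1 / 2 * ((((X.filter fun e => (e ∈ (fun q => A₁ q + t₁) '' fccStacking 1 (Real.sqrt (2 / 3)) ∧
                e 2 < h + R₀ + 2 ∧ e 0 ^ 2 + e 1 ^ 2 ≤ (ρ - 3) ^ 2) ∧
                e - A₁ w ∈ X ∧ (∀ v ∈ fccSlots, e - A₁ w + A₁ v ∈ X) ∧
                ∃ v ∈ fccSlots, e + A₁ v ∉ X).card : ℕ) : ℝ) -
            ((((X.filter fun e => (e ∈ (fun q => A₁ q + t₁) '' fccStacking 1 (Real.sqrt (2 / 3)) ∧
                e 2 < h + R₀ + 2 ∧ e 0 ^ 2 + e 1 ^ 2 ≤ (ρ - 3) ^ 2) ∧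
                e - A₁ w ∈ X ∧ (∀ v ∈ fccSlots, e - A₁ w + A₁ v ∈ X) ∧
                ∃ v ∈ fccSlots, e + A₁ v ∉ X).filter fun e => ∃ n : EuclideanSpace ℝ (Fin 3), ‖n‖ = 1 ∧
              n ≠ L (EuclideanSpace.single (2 : Fin 3) (1 : ℝ)) ∧
              n ≠ -L (EuclideanSpace.single (2 : Fin 3) (1 : ℝ)) ∧
              (∀ v ∈ fccSlots, ⟪A₁ v, n⟫_ℝ = 0 ∨ ⟪A₁ v, n⟫_ℝ = Real.sqrt (2 / 3) ∨
                ⟪A₁ v, n⟫_ℝ = -Real.sqrt (2 / 3)) ∧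
              ⟪A₁ w, n⟫_ℝ = Real.sqrt (2 / 3) ∧
              (∀ v ∈ fccSlots, ⟪A₁ v, n⟫_ℝ ≤ 0 → e + A₁ v ∈ X) ∧
              (∀ v ∈ fccSlots, 0 < ⟪A₁ v, n⟫_ℝ → e + A₁ v ∉ X ∧ e - A₁ v + (2 * ⟪A₁ v, n⟫_ℝ) • n ∈ X)).card
              : ℕ) : ℝ)) +
          C * (1 + h) * ρ := by
  obtain ⟨w, hw, hw0, hwup, hflux⟩ := exists_inPlane_slot_of_coaxial_sharp A₁ t₁ L s₁ hσ hsub₁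
  obtain ⟨C₁, hC₁⟩ := affineSampleDeficit_upper A₁ t₁ 10 (by norm_num)
  obtain ⟨C₂, hC₂⟩ := affineSampleDeficit_upper A₂ t₂ 10 (by norm_num)
  refine ⟨w, hw, hw0, hwup, hflux, (240 * Real.sqrt 2 * Real.pi + 3120 * (4 * 10 + 2)) / 2 + |C₁| + |C₂|, 10,
    by norm_num, ?_⟩
  intro h hh ρ hρ X P₁ P₂ hX hP₁X hP₂X hcell hP₁ hP₂
  set φ₁ : ℝ := Real.sqrt 2 / 4 * ∑ᶠ w ∈ {w ∈ fccStacking 1 (Real.sqrt (2 / 3)) | ‖w‖ = 1},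
      |⟪w, A₁.symm (EuclideanSpace.single (2 : Fin 3) (1 : ℝ))⟫_ℝ| with hφ₁
  set φ₂ : ℝ := Real.sqrt 2 / 4 * ∑ᶠ w ∈ {w ∈ fccStacking 1 (Real.sqrt (2 / 3)) | ‖w‖ = 1},
      |⟪w, A₂.symm (EuclideanSpace.single (2 : Fin 3) (1 : ℝ))⟫_ℝ| with hφ₂
  have hP₂X' : P₂ ⊆ X := hP₂X.trans Finset.sdiff_subset
  have hρ0 : (0 : ℝ) ≤ ρ := by linarith
  -- the three counted families, in the syntactic form of the statement
  set EXS : Finset (EuclideanSpace ℝ (Fin 3)) := X.filter fun e =>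
    (e ∈ (fun q => A₁ q + t₁) '' fccStacking 1 (Real.sqrt (2 / 3)) ∧
      e 2 < h + 10 + 2 ∧ e 0 ^ 2 + e 1 ^ 2 ≤ (ρ - 3) ^ 2) ∧
      e - A₁ w ∈ X ∧ (∀ v ∈ fccSlots, e - A₁ w + A₁ v ∈ X) ∧ ∃ v ∈ fccSlots, e + A₁ v ∉ X with hEXS
  set FTCS : Finset (EuclideanSpace ℝ (Fin 3)) := EXS.filter fun e => ∃ n : EuclideanSpace ℝ (Fin 3), ‖n‖ = 1 ∧
      n ≠ L (EuclideanSpace.single (2 : Fin 3) (1 : ℝ)) ∧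
      n ≠ -L (EuclideanSpace.single (2 : Fin 3) (1 : ℝ)) ∧
      (∀ v ∈ fccSlots, ⟪A₁ v, n⟫_ℝ = 0 ∨ ⟪A₁ v, n⟫_ℝ = Real.sqrt (2 / 3) ∨
        ⟪A₁ v, n⟫_ℝ = -Real.sqrt (2 / 3)) ∧
      ⟪A₁ w, n⟫_ℝ = Real.sqrt (2 / 3) ∧
      (∀ v ∈ fccSlots, ⟪A₁ v, n⟫_ℝ ≤ 0 → e + A₁ v ∈ X) ∧
      (∀ v ∈ fccSlots, 0 < ⟪A₁ v, n⟫_ℝ → e + A₁ v ∉ X ∧ e - A₁ v + (2 * ⟪A₁ v, n⟫_ℝ) • n ∈ X)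
    with hFTCS
  set PAYS : Finset (EuclideanSpace ℝ (Fin 3)) := X.filter fun y => (X.filter fun q => dist y q = 1).card ≠ 12 ∧
    ∃ e ∈ X, ((e ∈ (fun q => A₁ q + t₁) '' fccStacking 1 (Real.sqrt (2 / 3)) ∧
        e 2 < h + 10 + 2 ∧ e 0 ^ 2 + e 1 ^ 2 ≤ (ρ - 3) ^ 2) ∧
        e - A₁ w ∈ X ∧ (∀ v ∈ fccSlots, e - A₁ w + A₁ v ∈ X) ∧ ∃ v ∈ fccSlots, e + A₁ v ∉ X) ∧
      (y = e ∨ dist e y = 1 ∨ (∃ z ∈ X, dist e z = 1 ∧ dist z y = 1) ∨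
        ∃ z ∈ X, ∃ z' ∈ X, dist e z = 1 ∧ dist z z' = 1 ∧ dist z' y = 1) with hPAYS
  -- the located exits: on `Λ₁`, below `h + R₀ + 2`, off the rim
  have hQc : ∀ e ∈ X, (e ∈ (fun q => A₁ q + t₁) '' fccStacking 1 (Real.sqrt (2 / 3)) ∧
      e 2 < h + 10 + 2 ∧ e 0 ^ 2 + e 1 ^ 2 ≤ (ρ - 3) ^ 2) → e - A₁ w ∈ X →
      (∀ v ∈ fccSlots, e - A₁ w + A₁ v ∈ X) → e 2 < h + 12 := by
    intro e _ hQe _ _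
    have := hQe.2.1
    linarith
  -- the ledger with payers
  have hled : 2 * φ₁ * Real.pi * ρ ^ 2 + 2 * φ₂ * Real.pi * ρ ^ 2 + ((PAYS.card : ℕ) : ℝ) -
      (240 * Real.sqrt 2 * Real.pi + 3120 * (4 * 10 + 2)) * (1 + h) * ρ ≤
      ∑ x ∈ X, ((12 : ℝ) - ((X.filter fun q => dist x q = 1).card : ℝ)) := by
    have h0 := coaxial_ledger_ge_faces_add_payers_sealed A₁ t₁ A₂ t₂ X P₁ P₂ 10 h ρ le_rfl hh hρ hX hcell hP₁X hP₂X'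
      hP₁ hP₂ hw hwup (fun e => e ∈ (fun q => A₁ q + t₁) '' fccStacking 1 (Real.sqrt (2 / 3)) ∧
        e 2 < h + 10 + 2 ∧ e 0 ^ 2 + e 1 ^ 2 ≤ (ρ - 3) ^ 2) (h + 12) (by linarith) hQc
    rw [← finsum_unit_fcc_symm_eq_sum_slots A₁, ← finsum_unit_fcc_symm_eq_sum_slots A₂, ← hφ₁, ← hφ₂] at h0
    convert h0 using 4
  -- sources: the located exits along `w`
  have hEX : Real.sqrt 2 * |⟪A₁ w, EuclideanSpace.single (2 : Fin 3) (1 : ℝ)⟫_ℝ| * Real.pi * (ρ - 1) ^ 2 -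
      10 * Real.sqrt 2 * Real.pi * (ρ - 1) - 30 * (h + 4 * 10 + 2) * (2 * ρ - 3) ≤ ((EXS.card : ℕ) : ℝ) := by
    have h0 := card_located_exits_ge A₁ t₁ A₂ t₂ hne X P₁ P₂ 10 h ρ (by norm_num) hh hρ hX hP₁X hP₂X' hcell
      hP₁ hP₂ hw
    convert h0 using 3
  -- sinks: certified exits pay at the exit or are (foreign) caps
  have hPAY' : ((EXS.card : ℕ) : ℝ) ≤ ((FTCS.card : ℕ) : ℝ) + ((PAYS.card : ℕ) : ℝ) := by
    have h0 := card_exits_le_certified hX hs₀ hcert A₁ hw (fun e =>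
      e ∈ (fun q => A₁ q + t₁) '' fccStacking 1 (Real.sqrt (2 / 3)) ∧
        e 2 < h + 10 + 2 ∧ e 0 ^ 2 + e 1 ^ 2 ≤ (ρ - 3) ^ 2)
    rw [filter_twinCapped_eq_foreign_of_inPlane A₁ L X _ hw0] at h0
    have h1 : EXS.card ≤ FTCS.card + PAYS.card := by convert h0 using 6
    exact_mod_cast h1
  -- the two upper slab counts and the two splits
  have hD₁ := hC₁ (-(2 * 10)) (-10) (by ring) ρ hρ P₁ hP₁
  have hD₂ := hC₂ (h + 10) (h + 2 * 10) (by ring) ρ hρ P₂ hP₂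
  have hsplit₁ := contactDeficiency_sdiff_split hP₁X
  have hsplit₂ := contactDeficiency_sdiff_split hP₂X
  have htwo := two_mul_contactDeficiency_eq_sum X
  -- constants
  have hb : C₁ * ρ ≤ |C₁| * (1 + h) * ρ := by
    have h1 : 0 ≤ (|C₁| - C₁) * ρ := mul_nonneg (by linarith only [le_abs_self C₁]) hρ0
    have h2 : 0 ≤ |C₁| * h * ρ := by positivity
    linarith only [h1, h2]
  have hc' : C₂ * ρ ≤ |C₂| * (1 + h) * ρ := by
    have h1 : 0 ≤ (|C₂| - C₂) * ρ := mul_nonneg (by linarith only [le_abs_self C₂]) hρ0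
    have h2 : 0 ≤ |C₂| * h * ρ := by positivity
    linarith only [h1, h2]
  have hhρ : 0 ≤ h * ρ := mul_nonneg hh hρ0
  refine ⟨hEX, ?_⟩
  linarith only [hled, hPAY', hD₁, hD₂, hsplit₁, hsplit₂, htwo, hb, hc', hρ0, hh, hhρ]

open scoped Classical in
/-- **Net co-axial ledger, gap-input form** (`KissingGap δ`, `KissingClassification δ` by name; weight `1/3770`). -/
theorem coaxialTwoSlabAdhesion_netLedger
    {δ : ℝ} (hg : KissingGap δ) (hc : KissingClassification δ)
    (A₁ : EuclideanSpace ℝ (Fin 3) ≃ₗᵢ[ℝ] EuclideanSpace ℝ (Fin 3)) (t₁ : EuclideanSpace ℝ (Fin 3))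
    (A₂ : EuclideanSpace ℝ (Fin 3) ≃ₗᵢ[ℝ] EuclideanSpace ℝ (Fin 3)) (t₂ : EuclideanSpace ℝ (Fin 3))
    (L : EuclideanSpace ℝ (Fin 3) ≃ₗᵢ[ℝ] EuclideanSpace ℝ (Fin 3)) (s₁ : EuclideanSpace ℝ (Fin 3))
    {σ : ℤ → ℤ} (hσ : IsHaggSeq σ)
    (hsub₁ : (fun p => A₁ p + t₁) '' fccStacking 1 (Real.sqrt (2 / 3)) ⊆
      (fun p => L p + s₁) '' barlowStacking 1 (Real.sqrt (2 / 3)) σ)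
    (hne : (fun p => A₁ p + t₁) '' fccStacking 1 (Real.sqrt (2 / 3)) ≠
      (fun p => A₂ p + t₂) '' fccStacking 1 (Real.sqrt (2 / 3))) :
    ∃ w ∈ fccSlots, ⟪A₁ w, L (EuclideanSpace.single (2 : Fin 3) (1 : ℝ))⟫_ℝ = 0 ∧
      0 ≤ ⟪A₁ w, EuclideanSpace.single (2 : Fin 3) (1 : ℝ)⟫_ℝ ∧
      Real.sqrt 6 * Real.sqrt (1 - ⟪L (EuclideanSpace.single (2 : Fin 3) (1 : ℝ)),
          EuclideanSpace.single (2 : Fin 3) (1 : ℝ)⟫_ℝ ^ 2) ≤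
        2 * (Real.sqrt 2 * |⟪A₁ w, EuclideanSpace.single (2 : Fin 3) (1 : ℝ)⟫_ℝ|) ∧
    ∃ C R₀ : ℝ, 1 ≤ R₀ ∧ ∀ h : ℝ, 0 ≤ h → ∀ ρ : ℝ, R₀ ≤ ρ →
      ∀ X P₁ P₂ : Finset (EuclideanSpace ℝ (Fin 3)),
      (∀ p ∈ X, ∀ q ∈ X, p ≠ q → 1 ≤ dist p q) → P₁ ⊆ X → P₂ ⊆ X \ P₁ →
      (∀ p ∈ X, -(2 * R₀) ≤ p 2 ∧ p 2 ≤ h + 2 * R₀ ∧ p 0 ^ 2 + p 1 ^ 2 ≤ ρ ^ 2) →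
      (∀ p, p ∈ P₁ ↔ (p ∈ (fun q => A₁ q + t₁) '' fccStacking 1 (Real.sqrt (2 / 3)) ∧
        -(2 * R₀) ≤ p 2 ∧ p 2 ≤ -R₀ ∧ p 0 ^ 2 + p 1 ^ 2 ≤ ρ ^ 2)) →
      (∀ p, p ∈ P₂ ↔ (p ∈ (fun q => A₂ q + t₂) '' fccStacking 1 (Real.sqrt (2 / 3)) ∧
        h + R₀ ≤ p 2 ∧ p 2 ≤ h + 2 * R₀ ∧ p 0 ^ 2 + p 1 ^ 2 ≤ ρ ^ 2)) →
      Real.sqrt 2 * |⟪A₁ w, EuclideanSpace.single (2 : Fin 3) (1 : ℝ)⟫_ℝ| * Real.pi * (ρ - 1) ^ 2 -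
          10 * Real.sqrt 2 * Real.pi * (ρ - 1) - 30 * (h + 4 * R₀ + 2) * (2 * ρ - 3) ≤
        (((X.filter fun e => (e ∈ (fun q => A₁ q + t₁) '' fccStacking 1 (Real.sqrt (2 / 3)) ∧
                e 2 < h + R₀ + 2 ∧ e 0 ^ 2 + e 1 ^ 2 ≤ (ρ - 3) ^ 2) ∧
                e - A₁ w ∈ X ∧ (∀ v ∈ fccSlots, e - A₁ w + A₁ v ∈ X) ∧
                ∃ v ∈ fccSlots, e + A₁ v ∉ X).card : ℕ) : ℝ) ∧
      ((((P₁ ×ˢ (X \ P₁)).filter fun pq => dist pq.1 pq.2 = 1).card : ℕ) : ℝ) +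
        ((((P₂ ×ˢ ((X \ P₁) \ P₂)).filter fun pq => dist pq.1 pq.2 = 1).card : ℕ) : ℝ) ≤
        contactDeficiency ((X \ P₁) \ P₂) +
          (Real.sqrt 2 / 4 * ∑ᶠ w ∈ {w ∈ fccStacking 1 (Real.sqrt (2 / 3)) | ‖w‖ = 1},
              |⟪w, A₁.symm (EuclideanSpace.single (2 : Fin 3) (1 : ℝ))⟫_ℝ| +
            Real.sqrt 2 / 4 * ∑ᶠ w ∈ {w ∈ fccStacking 1 (Real.sqrt (2 / 3)) | ‖w‖ = 1},
              |⟪w, A₂.symm (EuclideanSpace.single (2 : Fin 3) (1 : ℝ))⟫_ℝ|) * Real.pi * ρ ^ 2 -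
          1 / 3770 * ((((X.filter fun e => (e ∈ (fun q => A₁ q + t₁) '' fccStacking 1 (Real.sqrt (2 / 3)) ∧
                e 2 < h + R₀ + 2 ∧ e 0 ^ 2 + e 1 ^ 2 ≤ (ρ - 3) ^ 2) ∧
                e - A₁ w ∈ X ∧ (∀ v ∈ fccSlots, e - A₁ w + A₁ v ∈ X) ∧
                ∃ v ∈ fccSlots, e + A₁ v ∉ X).card : ℕ) : ℝ) -
            ((((X.filter fun e => (e ∈ (fun q => A₁ q + t₁) '' fccStacking 1 (Real.sqrt (2 / 3)) ∧
                e 2 < h + R₀ + 2 ∧ e 0 ^ 2 + e 1 ^ 2 ≤ (ρ - 3) ^ 2) ∧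
                e - A₁ w ∈ X ∧ (∀ v ∈ fccSlots, e - A₁ w + A₁ v ∈ X) ∧
                ∃ v ∈ fccSlots, e + A₁ v ∉ X).filter fun e => ∃ n : EuclideanSpace ℝ (Fin 3), ‖n‖ = 1 ∧
              n ≠ L (EuclideanSpace.single (2 : Fin 3) (1 : ℝ)) ∧
              n ≠ -L (EuclideanSpace.single (2 : Fin 3) (1 : ℝ)) ∧
              (∀ v ∈ fccSlots, ⟪A₁ v, n⟫_ℝ = 0 ∨ ⟪A₁ v, n⟫_ℝ = Real.sqrt (2 / 3) ∨
                ⟪A₁ v, n⟫_ℝ = -Real.sqrt (2 / 3)) ∧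
              ⟪A₁ w, n⟫_ℝ = Real.sqrt (2 / 3) ∧
              (∀ v ∈ fccSlots, ⟪A₁ v, n⟫_ℝ ≤ 0 → e + A₁ v ∈ X) ∧
              (∀ v ∈ fccSlots, 0 < ⟪A₁ v, n⟫_ℝ → e + A₁ v ∉ X ∧ e - A₁ v + (2 * ⟪A₁ v, n⟫_ℝ) • n ∈ X)).card
              : ℕ) : ℝ)) +
          C * (1 + h) * ρ := by
  obtain ⟨w, hw, hw0, hwup, hflux⟩ := exists_inPlane_slot_of_coaxial_sharp A₁ t₁ L s₁ hσ hsub₁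
  obtain ⟨C₁, hC₁⟩ := affineSampleDeficit_upper A₁ t₁ 10 (by norm_num)
  obtain ⟨C₂, hC₂⟩ := affineSampleDeficit_upper A₂ t₂ 10 (by norm_num)
  refine ⟨w, hw, hw0, hwup, hflux, (240 * Real.sqrt 2 * Real.pi + 3120 * (4 * 10 + 2)) / 2 + |C₁| + |C₂|, 10,
    by norm_num, ?_⟩
  intro h hh ρ hρ X P₁ P₂ hX hP₁X hP₂X hcell hP₁ hP₂
  set φ₁ : ℝ := Real.sqrt 2 / 4 * ∑ᶠ w ∈ {w ∈ fccStacking 1 (Real.sqrt (2 / 3)) | ‖w‖ = 1},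
      |⟪w, A₁.symm (EuclideanSpace.single (2 : Fin 3) (1 : ℝ))⟫_ℝ| with hφ₁
  set φ₂ : ℝ := Real.sqrt 2 / 4 * ∑ᶠ w ∈ {w ∈ fccStacking 1 (Real.sqrt (2 / 3)) | ‖w‖ = 1},
      |⟪w, A₂.symm (EuclideanSpace.single (2 : Fin 3) (1 : ℝ))⟫_ℝ| with hφ₂
  have hP₂X' : P₂ ⊆ X := hP₂X.trans Finset.sdiff_subset
  have hρ0 : (0 : ℝ) ≤ ρ := by linarith
  -- the three counted families, in the syntactic form of the statement
  set EXS : Finset (EuclideanSpace ℝ (Fin 3)) := X.filter fun e =>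
    (e ∈ (fun q => A₁ q + t₁) '' fccStacking 1 (Real.sqrt (2 / 3)) ∧
      e 2 < h + 10 + 2 ∧ e 0 ^ 2 + e 1 ^ 2 ≤ (ρ - 3) ^ 2) ∧
      e - A₁ w ∈ X ∧ (∀ v ∈ fccSlots, e - A₁ w + A₁ v ∈ X) ∧ ∃ v ∈ fccSlots, e + A₁ v ∉ X with hEXS
  set FTCS : Finset (EuclideanSpace ℝ (Fin 3)) := EXS.filter fun e => ∃ n : EuclideanSpace ℝ (Fin 3), ‖n‖ = 1 ∧
      n ≠ L (EuclideanSpace.single (2 : Fin 3) (1 : ℝ)) ∧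
      n ≠ -L (EuclideanSpace.single (2 : Fin 3) (1 : ℝ)) ∧
      (∀ v ∈ fccSlots, ⟪A₁ v, n⟫_ℝ = 0 ∨ ⟪A₁ v, n⟫_ℝ = Real.sqrt (2 / 3) ∨
        ⟪A₁ v, n⟫_ℝ = -Real.sqrt (2 / 3)) ∧
      ⟪A₁ w, n⟫_ℝ = Real.sqrt (2 / 3) ∧
      (∀ v ∈ fccSlots, ⟪A₁ v, n⟫_ℝ ≤ 0 → e + A₁ v ∈ X) ∧
      (∀ v ∈ fccSlots, 0 < ⟪A₁ v, n⟫_ℝ → e + A₁ v ∉ X ∧ e - A₁ v + (2 * ⟪A₁ v, n⟫_ℝ) • n ∈ X)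
    with hFTCS
  set PAYS : Finset (EuclideanSpace ℝ (Fin 3)) := X.filter fun y => (X.filter fun q => dist y q = 1).card ≠ 12 ∧
    ∃ e ∈ X, ((e ∈ (fun q => A₁ q + t₁) '' fccStacking 1 (Real.sqrt (2 / 3)) ∧
        e 2 < h + 10 + 2 ∧ e 0 ^ 2 + e 1 ^ 2 ≤ (ρ - 3) ^ 2) ∧
        e - A₁ w ∈ X ∧ (∀ v ∈ fccSlots, e - A₁ w + A₁ v ∈ X) ∧ ∃ v ∈ fccSlots, e + A₁ v ∉ X) ∧
      (y = e ∨ dist e y = 1 ∨ (∃ z ∈ X, dist e z = 1 ∧ dist z y = 1) ∨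
        ∃ z ∈ X, ∃ z' ∈ X, dist e z = 1 ∧ dist z z' = 1 ∧ dist z' y = 1) with hPAYS
  -- the located exits (predicate `Q` of the restricted machinery): on `Λ₁`, below `h + R₀ + 2`, off the rim
  have hQc : ∀ e ∈ X, (e ∈ (fun q => A₁ q + t₁) '' fccStacking 1 (Real.sqrt (2 / 3)) ∧
      e 2 < h + 10 + 2 ∧ e 0 ^ 2 + e 1 ^ 2 ≤ (ρ - 3) ^ 2) → e - A₁ w ∈ X →
      (∀ v ∈ fccSlots, e - A₁ w + A₁ v ∈ X) → e 2 < h + 12 := by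
    intro e _ hQe _ _
    have := hQe.2.1
    linarith
  -- the ledger with payers
  have hled : 2 * φ₁ * Real.pi * ρ ^ 2 + 2 * φ₂ * Real.pi * ρ ^ 2 + ((PAYS.card : ℕ) : ℝ) -
      (240 * Real.sqrt 2 * Real.pi + 3120 * (4 * 10 + 2)) * (1 + h) * ρ ≤
      ∑ x ∈ X, ((12 : ℝ) - ((X.filter fun q => dist x q = 1).card : ℝ)) := by
    have h0 := coaxial_ledger_ge_faces_add_payers_sealed A₁ t₁ A₂ t₂ X P₁ P₂ 10 h ρ le_rfl hh hρ hX hcell hP₁X hP₂X'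
      hP₁ hP₂ hw hwup (fun e => e ∈ (fun q => A₁ q + t₁) '' fccStacking 1 (Real.sqrt (2 / 3)) ∧
        e 2 < h + 10 + 2 ∧ e 0 ^ 2 + e 1 ^ 2 ≤ (ρ - 3) ^ 2) (h + 12) (by linarith) hQc
    rw [← finsum_unit_fcc_symm_eq_sum_slots A₁, ← finsum_unit_fcc_symm_eq_sum_slots A₂, ← hφ₁, ← hφ₂] at h0
    convert h0 using 4
  -- sources: the located exits along `w`
  have hEX : Real.sqrt 2 * |⟪A₁ w, EuclideanSpace.single (2 : Fin 3) (1 : ℝ)⟫_ℝ| * Real.pi * (ρ - 1) ^ 2 -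
      10 * Real.sqrt 2 * Real.pi * (ρ - 1) - 30 * (h + 4 * 10 + 2) * (2 * ρ - 3) ≤ ((EXS.card : ℕ) : ℝ) := by
    have h0 := card_located_exits_ge A₁ t₁ A₂ t₂ hne X P₁ P₂ 10 h ρ (by norm_num) hh hρ hX hP₁X hP₂X' hcell
      hP₁ hP₂ hw
    convert h0 using 3
  -- sinks: exits pay or are capped
  have hPAY' : ((EXS.card : ℕ) : ℝ) ≤ ((FTCS.card : ℕ) : ℝ) + 1885 * ((PAYS.card : ℕ) : ℝ) := by
    have h0 := card_exits_le_restrict hg hc hX A₁ hw (fun e =>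
      e ∈ (fun q => A₁ q + t₁) '' fccStacking 1 (Real.sqrt (2 / 3)) ∧
        e 2 < h + 10 + 2 ∧ e 0 ^ 2 + e 1 ^ 2 ≤ (ρ - 3) ^ 2)
    rw [filter_twinCapped_eq_foreign_of_inPlane A₁ L X _ hw0] at h0
    have h1 : EXS.card ≤ FTCS.card + 1885 * PAYS.card := by convert h0 using 6
    exact_mod_cast h1
  -- the two upper slab counts and the two splits
  have hD₁ := hC₁ (-(2 * 10)) (-10) (by ring) ρ hρ P₁ hP₁
  have hD₂ := hC₂ (h + 10) (h + 2 * 10) (by ring) ρ hρ P₂ hP₂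
  have hsplit₁ := contactDeficiency_sdiff_split hP₁X
  have hsplit₂ := contactDeficiency_sdiff_split hP₂X
  have htwo := two_mul_contactDeficiency_eq_sum X
  -- constants
  have hb : C₁ * ρ ≤ |C₁| * (1 + h) * ρ := by
    have h1 : 0 ≤ (|C₁| - C₁) * ρ := mul_nonneg (by linarith only [le_abs_self C₁]) hρ0
    have h2 : 0 ≤ |C₁| * h * ρ := by positivity
    linarith only [h1, h2]
  have hc' : C₂ * ρ ≤ |C₂| * (1 + h) * ρ := by
    have h1 : 0 ≤ (|C₂| - C₂) * ρ := mul_nonneg (by linarith only [le_abs_self C₂]) hρ0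
    have h2 : 0 ≤ |C₂| * h * ρ := by positivity
    linarith only [h1, h2]
  have hhρ : 0 ≤ h * ρ := mul_nonneg hh hρ0
  refine ⟨hEX, ?_⟩
  linarith only [hled, hPAY', hD₁, hD₂, hsplit₁, hsplit₂, htwo, hb, hc', hρ0, hh, hhρ]

end Summit.Ventures.Crystal3D.Theorems

end
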